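import Summits.ValiantsHypothesis.ValiantsHypothesis.Theorems.KPlusLogSqLawTropicalStaticMountainDominance

/-!
# Route «KPlusLogSqLaw» — the static family MOUNTAIN, part 5: signs, the chain, and the STATIC `K = 3` ROW FROM BELOW

HONEST FRAMING.  Helper chain of the object-search cell `pub-symmetroid` (seat val-sym-lift-p1 g5, 2026-08-27) toward
the cruxes `WeakLifting` (ledger item `stmt-ValiantsHypothesis-19561`) / `TropicalB` (`stmt-ValiantsHypothesis-19771`) of
route `KPlusLogSqLaw`, in the vocabulary of `…CensusTropicalKLaw` / `…CensusTropicalKLawStatic` (`TropRootLawAt`,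
`TropRootLawAtStatic`, `IsStatic`, `IsDominant`, `termSign`, `tropWeight`).  It is a statement of FINITE TROPICAL
COMBINATORICS (an explicit dominance design per format `(m, 3)` and its chain); nothing here asserts or bears on `TropicalB`,
`WeakLifting`, `Lifting`, `KPlusLogSqLaw`, the cell's real census or registers (DoorA26 / DoorA34), `MatrixDescartes`
(`stmt-ValiantsHypothesis-18050`) or `VP ≠ VNP`.

Proved here (sorry-free):
* `termSign_mterm`: the sign of the mountain term `M_(y,z)` is `(−1)^(R z + y − 1)` = `(−1)^(rank in the chain)`;
* the chain `(0,0), (1,1), …, (m−1,1), (1,2), …, (1,m−1)` (`grid`): admissible, rank identity, strictly increasing slopes,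
  alternating signs, `R n = C(n+1, 2)` (`grid_inv`, `th_grid_lt`, `termSign_grid`, `R_last`);
* **`choose_two_le_of_tropRootLawAtStatic_three : TropRootLawAtStatic m 3 B → C(m,2) ≤ B`** for every `m` (and
  `not_tropRootLawAtStatic_three`): the STATIC tropical census row `(m, 3)` is at least `C(m,2) = m(m−1)/2` — the mountain
  design realises EVERY feasible sign-rule histogram as a uniquely dominant, sign-alternating term;
* `eq_of_isStatic_of_fst_eq` / `fst_ne_of_isStatic_of_alternating` (any format): in a static design present terms are
  determined by their permutations, so every sign change of a dominant chain is a PERMUTATION CHANGE.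
READING (located, not a claim about the cruxes): with three slope classes a sign-alternating dominant chain can change its
optimal permutation `C(m,2)` times on `m` rows — quadratically — against the «no family with more than `O(m)` permutation
changes per `O(1)` classes known» line of `…TropicalBPermutationBudget` (whose `tropicalB_iff_permSteps` makes the
permutation-change count the currency of `TropicalB`); the SHIFT-THREE family (`…TropicalShiftThreeChain`, `C(m+2,2) − 2`
sign changes) changes permutation only `m − 1` times.  The `K = 4` analogue (a cubic number of permutation changes — the
cell's «K = 4 fork», via `le_permChanges_add`) remains open.
-/

-- `Summit.ValiantsHypothesis.ValiantsHypothesis.…` repeats a component by the D-0017 layout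
-- (single-conjunct summit), which the `dupNamespace` linter flags; the name is mandated.
set_option linter.dupNamespace false
set_option autoImplicit false

namespace Summit.ValiantsHypothesis.ValiantsHypothesis.Theorems.LacunarySymmetroidMatrixDescartes.TropicalCensus

open Summit.ValiantsHypothesis.ValiantsHypothesis.Theorems.MatrixDescartes.Negative
open scoped BigOperators
open Finset

namespace Mountain

variable (n : ℕ)

/-- the entry signs met by the mountain. -/
theorem sgn_mtn {y z : ℕ} (h : 1 ≤ y ∧ 1 ≤ z ∧ y + z ≤ n + 1) (b : Fin (n + 1)) :
    sgn n (mtn n y z b) b = gsgn n y z b := by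
  have hv := mtn_val n h b
  unfold gsgn
  by_cases h0 : (b : ℕ) = 0
  · rw [if_pos h0, sgn_col0 n _ _ (by rw [hv, h0, mf_at0]; omega) h0]
    have : ((mtn n y z b : Fin (n + 1)) : ℕ) = z := by rw [hv, h0, mf_at0]
    have : mtn n y z b = ⟨z, by omega⟩ := Fin.ext this
    rw [this]
  rw [if_neg h0]
  by_cases h1 : (b : ℕ) < z
  · have hvb : ((mtn n y z b : Fin (n + 1)) : ℕ) = (b : ℕ) - 1 := by rw [hv, mf_desc y z b (by omega) h1]
    rw [if_neg (by omega), sgn_unitDesc n _ _ (by rw [hvb]; omega) (by rw [hvb]; omega)]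
  by_cases h2 : (b : ℕ) + 1 < z + y
  · have hvb : ((mtn n y z b : Fin (n + 1)) : ℕ) = (b : ℕ) + 1 := by rw [hv, mf_asc y z b (by omega) h2 h.2.1]
    rw [if_neg (by omega), sgn_unitAsc n _ _ (by rw [hvb]; omega) h0 hvb]
  by_cases h3 : (b : ℕ) + 1 = z + y
  · have hvb : ((mtn n y z b : Fin (n + 1)) : ℕ) = z - 1 := by rw [hv, mf_top y z b h3 h.2.1 h.1]
    by_cases hy2 : 2 ≤ y
    · rw [if_pos ⟨h3, hy2⟩, sgn_longDesc n _ _ (by rw [hvb]; omega) (by rw [hvb]; omega), hvb]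
      congr 1 <;> omega
    · rw [if_neg (fun h' => hy2 h'.2), sgn_unitDesc n _ _ (by rw [hvb]; omega) (by rw [hvb]; omega)]
  · have hvb : ((mtn n y z b : Fin (n + 1)) : ℕ) = (b : ℕ) := by rw [hv, mf_fix y z b (by omega) h.2.1]
    rw [if_neg (fun h' => h3 h'.1), show mtn n y z b = b from Fin.ext hvb, sgn_diag]

/-- the product of the entry signs met by the mountain. -/
theorem prod_gsgn {y z : ℕ} (h : 1 ≤ y ∧ 1 ≤ z ∧ y + z ≤ n + 1) :
    ∏ i ∈ range (n + 1), gsgn n y z i = csign n z * (if 2 ≤ y then lsign n y z else 1) := by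
  rw [prod_split5 n _ y z h]
  have p0 : gsgn n y z 0 = csign n z := by unfold gsgn; rw [if_pos rfl]
  have p1 : ∏ i ∈ Ico 1 z, gsgn n y z i = 1 := by
    refine Finset.prod_eq_one fun i hi => ?_
    have hi' := Finset.mem_Ico.mp hi
    unfold gsgn; rw [if_neg (by omega), if_neg (fun h' => by omega)]
  have p2 : ∏ i ∈ Ico z (z + y - 1), gsgn n y z i = 1 := by
    refine Finset.prod_eq_one fun i hi => ?_
    have hi' := Finset.mem_Ico.mp hi
    unfold gsgn; rw [if_neg (by omega), if_neg (fun h' => by omega)]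
  have p3 : gsgn n y z (z + y - 1) = if 2 ≤ y then lsign n y z else 1 := by
    unfold gsgn; rw [if_neg (by omega)]
    by_cases hy2 : 2 ≤ y
    · rw [if_pos ⟨by omega, hy2⟩, if_pos hy2]
    · rw [if_neg (fun h' => hy2 h'.2), if_neg hy2]
  have p4 : ∏ i ∈ Ico (z + y) (n + 1), gsgn n y z i = 1 := by
    refine Finset.prod_eq_one fun i hi => ?_
    have hi' := Finset.mem_Ico.mp hi
    unfold gsgn; rw [if_neg (by omega), if_neg (fun h' => by omega)]
  rw [p0, p1, p2, p3, p4]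
  ring

/-- **sign of the mountain term**: `(−1)^(R z + y − 1)` = `(−1)^(rank of (y,z) in the chain)`. -/
theorem termSign_mterm (y z : ℕ) (h : (y = 0 ∧ z = 0) ∨ (1 ≤ y ∧ 1 ≤ z ∧ y + z ≤ n + 1)) :
    termSign (ee n) (mterm n y z) = (-1) ^ (R n z + y - 1) := by
  unfold termSign mterm
  dsimp only
  rw [Finset.prod_congr rfl (fun b _ => (by unfold ee; rw [if_pos rfl] : ee n (mtn n y z b) b (cls n (mtn n y z b) b) =
    sgn n (mtn n y z b) b))]
  rcases h with ⟨rfl, rfl⟩ | h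
  · rw [mtn_zero_zero, Equiv.Perm.sign_one]
    simp [sgn_diag, R]
  · rw [Finset.prod_congr rfl (fun b _ => sgn_mtn n h b), Fin.prod_univ_eq_prod_range (gsgn n y z) (n + 1),
      prod_gsgn n h]
    have s1 := sign_sq n (mtn n y z)
    have s2 := sign_sq n (mtn n 1 z)
    by_cases hy2 : 2 ≤ y
    · rw [if_pos hy2]
      unfold csign lsign
      rw [show R n z + y - 1 = R n z + (y - 1) by omega, pow_add]
      linear_combination ((-1 : ℤ) ^ R n z * (-1) ^ (y - 1) *
        (((Equiv.Perm.sign (mtn n 1 z) : ℤˣ) : ℤ) * ((Equiv.Perm.sign (mtn n 1 z) : ℤˣ) : ℤ))) * s1 +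
        ((-1 : ℤ) ^ R n z * (-1) ^ (y - 1)) * s2
    · obtain rfl : y = 1 := by omega
      rw [if_neg (by omega), mul_one, show R n z + 1 - 1 = R n z by omega]
      unfold csign
      linear_combination ((-1 : ℤ) ^ R n z) * s2

/-- `R 0 = 0`. -/
theorem R_zero : R n 0 = 0 := rfl

/-- `R 1 = 1`. -/
theorem R_one : R n 1 = 1 := rfl

/-- the rank recursion for `z ≥ 1`. -/
theorem R_succ (z : ℕ) (hz : 1 ≤ z) : R n (z + 1) = R n z + (n + 1 - z) := by
  obtain ⟨z', rfl⟩ : ∃ z', z = z' + 1 := ⟨z - 1, by omega⟩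
  show R n (z' + 2) = R n (z' + 1) + (n + 1 - (z' + 1))
  rw [show n + 1 - (z' + 1) = n - z' by omega]
  rfl

/-- closed form of the rank function: `2·R z = 2 + 2(z−1)(n+1) − z(z−1)` for `1 ≤ z ≤ n+1`. -/
theorem two_mul_R (z : ℕ) (hz : 1 ≤ z) (hzn : z ≤ n + 1) :
    (2 : ℤ) * (R n z : ℕ) = 2 + 2 * ((z : ℤ) - 1) * ((n : ℤ) + 1) - (z : ℤ) * ((z : ℤ) - 1) := by
  induction z with
  | zero => omega
  | succ z ih =>
    rcases Nat.eq_zero_or_pos z with rfl | hz1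
    · simp [R_one]
    · have ih' := ih hz1 (by omega)
      rw [R_succ n z hz1]
      push_cast
      have : ((n + 1 - z : ℕ) : ℤ) = (n : ℤ) + 1 - z := by omega
      rw [this]
      linarith

/-- the chain has `C(m, 2) + 1` points: `R n = C(n+1, 2)`. -/
theorem R_last : R n n = (n + 1).choose 2 := by
  rcases Nat.eq_zero_or_pos n with hn | hn
  · subst hn; rfl
  · have h1 := two_mul_R n n hn (by omega)
    have h2 := two_mul_choose_two (n + 1)
    push_cast at h2
    have : ((R n n : ℕ) : ℤ) = (((n + 1).choose 2 : ℕ) : ℤ) := by nlinarith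
    exact_mod_cast this

/-- the rank function is monotone. -/
theorem R_le_R_succ (z : ℕ) : R n z ≤ R n (z + 1) := by
  rcases Nat.eq_zero_or_pos z with rfl | hz
  · simp [R_zero, R_one]
  · rw [R_succ n z hz]; omega

/-- the grid invariant: the `k`-th point is `(0,0)` for `k = 0` and an admissible `(z, y)` of rank `k` otherwise. -/
theorem grid_inv (k : ℕ) (hk : k ≤ R n n) :
    (k = 0 → grid n k = (0, 0)) ∧
      (0 < k → 1 ≤ (grid n k).2 ∧ 1 ≤ (grid n k).1 ∧ (grid n k).2 + (grid n k).1 ≤ n + 1 ∧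
        R n (grid n k).1 + (grid n k).2 - 1 = k) := by
  induction k with
  | zero => exact ⟨fun _ => rfl, fun h => absurd h (lt_irrefl 0)⟩
  | succ k ih =>
    refine ⟨fun h => absurd h (Nat.succ_ne_zero k), fun _ => ?_⟩
    obtain ⟨ih0, ih1⟩ := ih (Nat.le_of_succ_le hk)
    rw [show grid n (k + 1) = step n (grid n k) from Function.iterate_succ_apply' _ _ _]
    rcases Nat.eq_zero_or_pos k with hk0 | hk0
    · subst hk0
      rw [ih0 rfl]
      unfold step
      rw [if_pos rfl]
      have hn : 1 ≤ n := by
        by_contra h0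
        have : n = 0 := by omega
        subst this
        simp [R_zero] at hk
      refine ⟨le_rfl, le_rfl, ?_, ?_⟩
      · show 1 + 1 ≤ n + 1
        omega
      · show R n 1 + 1 - 1 = 0 + 1
        rfl
    · obtain ⟨hy, hz, hyz, hr⟩ := ih1 hk0
      unfold step
      rw [if_neg (by omega)]
      by_cases hc : (grid n k).2 + (grid n k).1 < n + 1
      · rw [if_pos hc]
        simp only
        omega
      · rw [if_neg hc]
        simp only
        have heq : (grid n k).2 + (grid n k).1 = n + 1 := by omega
        have hRs := R_succ n (grid n k).1 hz
        -- `z < n`: otherwise the chain would already be over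
        have hzn : (grid n k).1 + 1 ≤ n := by
          by_contra hcon
          have hz' : (grid n k).1 = n := by omega
          rw [hz'] at hr
          omega
        refine ⟨le_rfl, by omega, by omega, ?_⟩
        rw [hRs]
        omega

/-- admissibility of the `k`-th grid point, in the form used by the term lemmas. -/
theorem grid_adm (k : ℕ) (hk : k ≤ R n n) :
    ((grid n k).2 = 0 ∧ (grid n k).1 = 0) ∨
      (1 ≤ (grid n k).2 ∧ 1 ≤ (grid n k).1 ∧ (grid n k).2 + (grid n k).1 ≤ n + 1) := by
  obtain ⟨h0, h1⟩ := grid_inv n k hk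
  rcases Nat.eq_zero_or_pos k with hk0 | hk0
  · left; rw [h0 hk0]; exact ⟨rfl, rfl⟩
  · right; obtain ⟨a, b, c, _⟩ := h1 hk0; exact ⟨a, b, c⟩

/-- the rank identity along the grid. -/
theorem grid_rank (k : ℕ) (hk : k ≤ R n n) : R n (grid n k).1 + (grid n k).2 - 1 = k := by
  obtain ⟨h0, h1⟩ := grid_inv n k hk
  rcases Nat.eq_zero_or_pos k with hk0 | hk0
  · rw [h0 hk0, hk0]; rfl
  · exact (h1 hk0).2.2.2

/-- the slopes increase along the grid. -/
theorem th_grid_lt (k : ℕ) (hk : k + 1 ≤ R n n) :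
    th n (grid n k).2 (grid n k).1 < th n (grid n (k + 1)).2 (grid n (k + 1)).1 := by
  obtain ⟨h0, h1⟩ := grid_inv n k (Nat.le_of_succ_le hk)
  rw [show grid n (k + 1) = step n (grid n k) from Function.iterate_succ_apply' _ _ _]
  unfold th
  rcases Nat.eq_zero_or_pos k with hk0 | hk0
  · subst hk0
    rw [h0 rfl]
    unfold step
    rw [if_pos rfl]
    simp only [pow_zero, pow_one]
    have := Q_pos n
    push_cast
    linarith
  · obtain ⟨hy, hz, hyz, hr⟩ := h1 hk0
    unfold step
    rw [if_neg (by omega)]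
    by_cases hc : (grid n k).2 + (grid n k).1 < n + 1
    · rw [if_pos hc]
      simp only
      have := Q_pow_pos n (grid n k).1
      push_cast
      nlinarith
    · rw [if_neg hc]
      simp only
      rw [pow_succ]
      have hP := Q_pow_pos n (grid n k).1
      have hQ := eight_le_Q n
      have hy' : ((grid n k).2 : ℤ) ≤ (n : ℤ) + 1 := by exact_mod_cast (show (grid n k).2 ≤ n + 1 by omega)
      have hQy : ((grid n k).2 : ℤ) < Q n := by
        have := choose_two_add_le_Q n 0 (by omega)
        simp at this
        linarith
      push_cast
      nlinarith

/-- the term signs alternate along the grid: the `k`-th sign is `(−1)^k`. -/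
theorem termSign_grid (k : ℕ) (hk : k ≤ R n n) :
    termSign (ee n) (mterm n (grid n k).2 (grid n k).1) = (-1) ^ k := by
  rw [termSign_mterm n _ _ (grid_adm n k hk), grid_rank n k hk]

/-- every grid term is dominant at its slope. -/
theorem isDominant_grid (k : ℕ) (hk : k ≤ R n n) :
    IsDominant (dd n) (vv n) (ee n) (th n (grid n k).2 (grid n k).1) (mterm n (grid n k).2 (grid n k).1) :=
  isDominant_mterm n _ _ (grid_adm n k hk)

/-- **the static tropical row `(m, 3)`, `m = n + 1`, is at least `C(m, 2)`**: the mountain design is a static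
three-class design with a sign-alternating dominant chain of `C(m,2) + 1` terms. -/
theorem le_of_tropRootLawAtStatic_three_succ (B : ℕ) (h : TropRootLawAtStatic (n + 1) 3 B) : R n n ≤ B := by
  refine h (dd n) (vv n) (ee n) (R n n) (fun k => th n (grid n k).2 (grid n k).1)
    (fun k => mterm n (grid n k).2 (grid n k).1) (fun i j l => Nat.le_of_lt_succ (ee_natAbs_lt_two n i j l))
    (isStatic_ee n) ?_ ?_ ?_
  · refine Fin.strictMono_iff_lt_succ.mpr fun k => ?_
    simp only [Fin.val_castSucc, Fin.val_succ]
    exact th_grid_lt n k (by omega)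
  · intro k
    exact isDominant_grid n k (by omega)
  · intro k
    simp only [Fin.val_castSucc, Fin.val_succ]
    rw [termSign_grid n k (by omega), termSign_grid n (k + 1) (by omega), ← pow_add,
      show (k : ℕ) + (k + 1) = 2 * k + 1 by ring, pow_succ, pow_mul]
    norm_num

end Mountain

/-- in a STATIC design two present terms with the same permutation coincide (the class map is forced). -/
theorem eq_of_isStatic_of_fst_eq {m K : ℕ} (ε : Fin m → Fin m → Fin K → ℤ) (hε : IsStatic ε)
    (p q : Equiv.Perm (Fin m) × (Fin m → Fin K)) (hp : termSign ε p ≠ 0) (hq : termSign ε q ≠ 0)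
    (h : p.1 = q.1) : p = q := by
  refine Prod.ext h (funext fun i => ?_)
  have h1 := present_of_termSign_ne_zero ε p hp i
  have h2 := present_of_termSign_ne_zero ε q hq i
  rw [h] at h1
  exact hε _ _ _ _ h1 h2

/-- hence in a static design every sign change of a dominant chain is a PERMUTATION CHANGE. -/
theorem fst_ne_of_isStatic_of_alternating {m K : ℕ} (ε : Fin m → Fin m → Fin K → ℤ) (hε : IsStatic ε)
    (p q : Equiv.Perm (Fin m) × (Fin m → Fin K)) (h : termSign ε p * termSign ε q < 0) : p.1 ≠ q.1 := by
  intro hpq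
  have hp : termSign ε p ≠ 0 := fun h0 => by rw [h0, zero_mul] at h; exact lt_irrefl _ h
  have hq : termSign ε q ≠ 0 := fun h0 => by rw [h0, mul_zero] at h; exact lt_irrefl _ h
  have := eq_of_isStatic_of_fst_eq ε hε p q hp hq hpq
  rw [this] at h
  exact absurd h (not_lt.mpr (mul_self_nonneg _))

/-- **The static `K = 3` tropical row is at least `C(m, 2)`** (`T_static(m,3) ≥ m(m−1)/2`): for every `m` there is
a STATIC three-class dominance design of format `(m, 3)` (the MOUNTAIN design: classes by the sign rule
`[a = b | a > b | a < b]`, exponents `(0, 1, m+2)`) with a sign-alternating chain of `C(m,2) + 1` uniquely dominant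
terms — one for EVERY feasible class histogram `(m − y − z, y, z)` — whose permutations are pairwise distinct
(`fst_ne_of_isStatic_of_alternating`: `C(m,2)` permutation changes with three slope classes). -/
theorem choose_two_le_of_tropRootLawAtStatic_three (m B : ℕ) (h : TropRootLawAtStatic m 3 B) :
    m.choose 2 ≤ B := by
  rcases m with _ | n
  · simp
  · rw [← Mountain.R_last n]
    exact Mountain.le_of_tropRootLawAtStatic_three_succ n B h

/-- the same as a non-law: `¬ T_static(m, 3) ≤ C(m,2) − 1` for `m ≥ 2`. -/
theorem not_tropRootLawAtStatic_three (m : ℕ) (hm : 2 ≤ m) : ¬ TropRootLawAtStatic m 3 (m.choose 2 - 1) := by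
  intro h
  have h1 := choose_two_le_of_tropRootLawAtStatic_three m _ h
  have h2 : 1 ≤ m.choose 2 := Nat.choose_pos hm
  omega

/-- and through the static reduction the general row: `TropRootLawAt m 3 B → C(m,2) ≤ B` (weaker than SHIFT-THREE's
`C(m+2,2) − 2 ≤ B`, recorded for the permutation-change reading). -/
theorem choose_two_le_of_tropRootLawAt_three' (m B : ℕ) (h : TropRootLawAt m 3 B) : m.choose 2 ≤ B :=
  choose_two_le_of_tropRootLawAtStatic_three m B (tropRootLawAtStatic_of_tropRootLawAt h)

end Summit.ValiantsHypothesis.ValiantsHypothesis.Theorems.LacunarySymmetroidMatrixDescartes.TropicalCensus
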